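import Literature.NumberTheory.ComplexMultiplication.DegenerateCMTypesCompositeDimensionRank
import Literature.AlgebraicGeometry.ComplexMultiplication.SimpleIffPrimitiveCMType
import Literature.AlgebraicGeometry.Motives.MumfordTateRankOfCMTypeUpperBound
import Literature.AlgebraicGeometry.Motives.HodgeTensorFactsHolds
import Literature.AlgebraicGeometry.HodgeTheory.ComplexConjugationHolds
import Literature.AlgebraicGeometry.HodgeTheory.HodgeFiltrationModelsReductionProofs
import Literature.NumberTheory.Automorphic.PicardCMPrerequisites
import HarnessLib

/-!
# Dodson's converse of Ribet's theorem on the variety: SIMPLE DEGENERATE abelian varieties of CM type of rank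
# `n − l + 2` for every `n = kl`, `k ≥ 3`, `l ≥ 2` (Dodson 1984, §3.2.1) — number-field and abelian-variety dress

B. Dodson, *The structure of Galois groups of CM-fields*, Trans. AMS **283** (1984) [Dodson1984], §3.2.1 (held text
`paper:doi-10-2307-1999987`, p. 13):

> "THEOREM (A Converse of Ribet's Theorem [15]).  Let `n > 4` be composite and factor `n` as `n = kl`, with `k ≥ 3`,
> `l ≥ 2`.  Then there exist simple degenerate Abelian varieties of dimension `n` and rank `n − l + 2`.
> *Proof.* Observe that there exist cyclic totally real fields for every `n`, so there exist CM-fields `K` with `K/ℚ`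
> Abelian and `Gal(K/ℚ) = ⟨ρ⟩ × ℤₙ = G`. […] consider the type defined by `f = ((1, …, 1), 0_l, …, 0_l)` […]
> `rank(K, Φᶠ) = n − l + 2` […]. Finally, note that `Φ` is primitive since the orbit of `f` under `G` has order `2n`."

(§3.1.0, p. 11: "The rank of `A`, `t(A) = t(Φ)`, is the rank of the free `ℤ`-module `M` spanned by the `Gal(Kᶜ/ℚ)` orbit
of `Φ` […] the rank of `A` is `n + 1` and `A` is said to be nondegenerate. The variety `A` is said to be degenerate
when `rank(A) = rank(K, Φ) < n + 1`"; "`(K, Φ)` is said to be primitive, and `A` is simple, when `((K, Φ)′)′ = (K, Φ)`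
(Shimura [19])".)

This file dresses the group-level theorems of `NumberTheory/ComplexMultiplication/DegenerateCMTypesCompositeDimension`
(`…Rank`) on the tree's carriers.  DODSON'S FIELDS: `K` a CM field, normal over `ℚ` with COMMUTATIVE Galois group
`Gal(K/ℚ) = ⟨ρ⟩ × ⟨σ⟩` — `ρ` the complex conjugation (`φ₀ ∘ ρ = conj ∘ φ₀`), `σ` of order `n` with `ρ ∉ ⟨σ⟩`,
`[K : ℚ] = 2n` (i.e. `K = K₀·k`, `K₀` cyclic totally real of degree `n`, `k` imaginary quadratic).  DODSON'S TYPE: the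
`Motives.CMType K` whose members, in Shimura's indexing `σ_g = φ₀ ∘ g⁻¹` (`Pohlmann1968.embOf`), are
`{σ_{σⁱ} : l ≤ i < n} ∪ {σ_{ρσⁱ} : i < l}` (hypotheses `hΦσ`, `hΦρ`; it exists: `exists_cmType_blockType`).  PROVED:

* `cmTypeRank_blockType` — **`Rank(K; Φᶠ) = n − l + 2`** (`cmTypeRank`, the Kubota–Dodson rank with `Aut(ℂ)` acting
  on `Hom(K, ℂ)`, = the Galois-group rank by `cmTypeRank_eq_typeRank_gal`); `not_isNondegenerate_blockType` —
  DEGENERATE for `l ≥ 2`;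
* `isPrimitive_blockType` — **`(K; Φᶠ)` is PRIMITIVE** (`IsPrimitive (ℂ ≃+* ℂ) Φ.1 φh`, Shimura Prop. 26 form) for
  `2l < n`;
* on every abelian variety `(A, ι, θ)` of CM type `(K; Φᶠ)` read on `H¹` (`IsCMTypeRealisation`), `n = kl`, `k ≥ 3`,
  `l ≥ 2`: `isSimple_blockType` (**simple**), `dim_eq_blockType` (**`dim A = n`**), `mtRank_hodge_one_blockType`
  (**`dim MT(H¹(A)) = n − l + 2`**, Dodson's rank `t(A)`; via the tree's `mtRank_bettiHodge_eq_cmTypeRank'`),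
  `exists_exceptional_pow_blockType` (**some power `Aᴺ` carries a rational `(m,m)`-class outside `Dᵐ(Aᴺ) ⊗ ℂ`** —
  degenerate ⟹ exceptional Hodge classes, Pohlmann/Hazama, tree `exists_exceptional_pow_of_not_isNondegenerate`);
* `exists_simple_degenerate_of_gal` — **§3.2.1 for Dodson's fields**: every such `K` carries a primitive degenerate
  CM type of rank `n − l + 2` all of whose realisations are simple degenerate abelian `n`-folds with exceptional
  Hodge classes on a power; `exists_simple_degenerate_of_cmAbelianVarietyRealised` — hence, granted the existence
  of abelian varieties of prescribed CM type (Shimura §6.2 Thm. 3 = the tree's record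
  `PicardCM.CMAbelianVarietyRealised`, a HYPOTHESIS here, proved Summits-side), simple degenerate abelian varieties
  of dimension `n` and rank `n − l + 2` EXIST over every such field.

The existence of the fields themselves for every `n` ("there exist cyclic totally real fields for every `n`") is not
re-proved in this file.  Theorems only; no definition, no named fact (claim DODSON-CONVERSE, COR-CM literature seat).

## References

* [Dodson1984] B. Dodson, Trans. AMS 283 (1984), §3.1.0–§3.2.1, pp. 11–13.
* [Kubota1965] T. Kubota, Trans. AMS 118 (1965), §4 Lemma 2.
* [Shimura1998] G. Shimura, *Abelian Varieties with Complex Multiplication and Modular Functions*, §8.2 Prop. 26,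
  §6.2 Thm. 3, §18.2.
* [Gordon1999HodgeAVSurvey] B. B. Gordon, *A survey of the Hodge conjecture for abelian varieties*, Thm. 6.4, §9.1, §9.4.
-/

set_option autoImplicit false

noncomputable section

open scoped BigOperators NumberField
open CategoryTheory NumberField

namespace Literature.AlgebraicGeometry.Pohlmann1968

open Literature.NumberTheory.ComplexMultiplication
open Literature.NumberTheory.ComplexMultiplication.Dodson1984
open Literature.AlgebraicGeometry.Motives (AbelianVariety CMType)
open Literature.AlgebraicGeometry.HodgeTheory
open Literature.AlgebraicGeometry.ComplexMultiplication (IsCMTypeRealisation isSimple_iff_isPrimitive)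
open Literature.Barriers.HodgeConjecture (divisorClassesSpan)

variable {K : Type} [Field K] [NumberField K] [IsCMField K] [Normal ℚ K]
variable {ρ σ : K ≃ₐ[ℚ] K} {φ₀ : K →+* ℂ} {n l : ℕ}

/-! ### §1 Dodson's fields `Gal(K/ℚ) = ⟨ρ⟩ × ⟨σ⟩`: bookkeeping on the Galois group -/

omit [IsCMField K] [Normal ℚ K] in
/-- `ρ² = 1` for the complex conjugation `ρ ∈ Gal(K/ℚ)` (`φ₀ ∘ ρ = conj ∘ φ₀`). [cite: Shimura1998, §18.2 Lemma (i)] -/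
theorem conjGalElt_mul_self (hρ : ∀ x, φ₀ (ρ x) = starRingEnd ℂ (φ₀ x)) : ρ * ρ = 1 := by
  apply AlgEquiv.ext
  intro x
  apply φ₀.injective
  rw [AlgEquiv.mul_apply, hρ, hρ, starRingEnd_self_apply, AlgEquiv.one_apply]

omit [Normal ℚ K] in
/-- `ρ ≠ 1`: a CM field has no real embedding. [cite: Shimura1998, §18.2 Lemma (i)] -/
theorem conjGalElt_ne_one (hρ : ∀ x, φ₀ (ρ x) = starRingEnd ℂ (φ₀ x)) : ρ ≠ 1 := by
  intro h1
  have hreal : ComplexEmbedding.IsReal φ₀ := by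
    refine RingHom.ext fun x => ?_
    change starRingEnd ℂ (φ₀ x) = φ₀ x
    rw [← hρ, h1, AlgEquiv.one_apply]
  exact IsTotallyComplex.complexEmbedding_not_isReal φ₀ hreal

omit [IsCMField K] in
/-- `|Gal(K/ℚ)| = [K : ℚ]` for `K/ℚ` normal (`g ↦ σ_g` is a bijection onto `Hom(K, ℂ)`). [cite: Shimura1998, §8.1] -/
theorem card_gal_eq_finrank (φ₀ : K →+* ℂ) : Fintype.card (K ≃ₐ[ℚ] K) = Module.finrank ℚ K := by
  rw [Fintype.card_congr (Equiv.ofBijective (embOf φ₀) (embOf_bijective φ₀))]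
  exact NumberField.Embeddings.card K ℂ

omit [IsCMField K] [Normal ℚ K] in
/-- **`σ̄_g = σ_{ρg}`**: complex conjugation acts on Shimura's embeddings `σ_g = φ₀ ∘ g⁻¹` through `ρ` (commutative
Galois group). [cite: Shimura1998, §18.2 Lemma (i)] -/
theorem conjugate_embOf (hcomm : ∀ g h : K ≃ₐ[ℚ] K, g * h = h * g)
    (hρ : ∀ x, φ₀ (ρ x) = starRingEnd ℂ (φ₀ x)) (g : K ≃ₐ[ℚ] K) :
    ComplexEmbedding.conjugate (embOf φ₀ g) = embOf φ₀ (ρ * g) := by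
  have hρinv : ρ⁻¹ = ρ := by rw [inv_eq_iff_mul_eq_one, conjGalElt_mul_self hρ]
  have h := smul_embOf_of_comp φ₀ (τ := starRingAut) (δ := ρ) (fun x => (hρ x).symm) g
  rw [conj_smul_eq_conjugate] at h
  rw [h, hρinv, hcomm]

/-! ### §2 Dodson's type `Φᶠ` on `K` and its rank -/

omit [IsCMField K] in
/-- **Dodson's type exists on `K`**: a CM type `Φ` of `K` with `σ_{σⁱ} ∈ Φ ↔ l ≤ i mod n` and
`σ_{ρσⁱ} ∈ Φ ↔ i mod n < l` ("consider the type defined by `f = ((1,…,1), 0_l, …, 0_l)`").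
[cite: Dodson1984, §3.2.1 Theorem (proof)] -/
theorem exists_cmType_blockType (hcomm : ∀ g h : K ≃ₐ[ℚ] K, g * h = h * g)
    (hρ : ∀ x, φ₀ (ρ x) = starRingEnd ℂ (φ₀ x)) (hσ : orderOf σ = n) (hρσ : ρ ∉ Subgroup.zpowers σ)
    (hK : Module.finrank ℚ K = 2 * n) (l : ℕ) :
    ∃ Φ : CMType K, (∀ i : ℕ, embOf φ₀ (σ ^ i) ∈ Φ.1 ↔ l ≤ i % n) ∧
      (∀ i : ℕ, embOf φ₀ (ρ * σ ^ i) ∈ Φ.1 ↔ i % n < l) := by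
  classical
  letI : CommGroup (K ≃ₐ[ℚ] K) := { (inferInstance : Group (K ≃ₐ[ℚ] K)) with mul_comm := hcomm }
  have hcard : Fintype.card (K ≃ₐ[ℚ] K) = 2 * n := by rw [card_gal_eq_finrank φ₀, hK]
  obtain ⟨ΦG, hΦσ, hΦρ⟩ := exists_blockType hσ hρσ l
  have hcm := isCMTypeWith_blockType (conjGalElt_mul_self hρ) hσ hρσ hcard hΦσ hΦρ
  have hinj := (embOf_bijective φ₀).1
  refine ⟨⟨{φ | ∃ g ∈ ΦG, embOf φ₀ g = φ}, fun φ => ?_⟩, fun i => ?_, fun i => ?_⟩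
  · obtain ⟨g, rfl⟩ := (embOf_bijective φ₀).2 φ
    rw [conjugate_embOf hcomm hρ]
    have hmem : ∀ h : K ≃ₐ[ℚ] K, (embOf φ₀ h ∈ {φ : K →+* ℂ | ∃ g ∈ ΦG, embOf φ₀ g = φ}) ↔ h ∈ ΦG :=
      fun h => ⟨fun ⟨g', hg', he⟩ => hinj he ▸ hg', fun hh => ⟨h, hh, rfl⟩⟩
    rw [hmem, hmem]
    have := hcm.mem_iff g
    simpa [smul_eq_mul] using this
  · exact ⟨fun ⟨g', hg', he⟩ => (hΦσ i).1 (hinj he ▸ hg'), fun h => ⟨σ ^ i, (hΦσ i).2 h, rfl⟩⟩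
  · exact ⟨fun ⟨g', hg', he⟩ => (hΦρ i).1 (hinj he ▸ hg'), fun h => ⟨ρ * σ ^ i, (hΦρ i).2 h, rfl⟩⟩

section BlockType

variable {Φ : CMType K}

omit [IsCMField K] [Normal ℚ K] in
open scoped Classical in
/-- The Galois-level type `{g | σ_g ∈ Φ}` as a finite set, and its two membership rules. [folklore] -/
private theorem galoisType_spec (hΦσ : ∀ i : ℕ, embOf φ₀ (σ ^ i) ∈ Φ.1 ↔ l ≤ i % n)
    (hΦρ : ∀ i : ℕ, embOf φ₀ (ρ * σ ^ i) ∈ Φ.1 ↔ i % n < l) :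
    (({g : K ≃ₐ[ℚ] K | embOf φ₀ g ∈ Φ.1} : Set (K ≃ₐ[ℚ] K)) =
        ↑(Finset.univ.filter fun g : K ≃ₐ[ℚ] K => embOf φ₀ g ∈ Φ.1)) ∧
      (∀ i : ℕ, σ ^ i ∈ (Finset.univ.filter fun g : K ≃ₐ[ℚ] K => embOf φ₀ g ∈ Φ.1) ↔ l ≤ i % n) ∧
      (∀ i : ℕ, ρ * σ ^ i ∈ (Finset.univ.filter fun g : K ≃ₐ[ℚ] K => embOf φ₀ g ∈ Φ.1) ↔ i % n < l) := by
  refine ⟨?_, fun i => ?_, fun i => ?_⟩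
  · ext g; simp
  · rw [Finset.mem_filter]; simpa using hΦσ i
  · rw [Finset.mem_filter]; simpa using hΦρ i

/-- **`Rank(K; Φᶠ) = n − l + 2`** (`l ∣ n`, `0 < l`, `2l ≠ n`) — "`r = (k − 1)l + 1` in the constant weight
criterion, so `rank(K, Φᶠ) = n − l + 2`". [cite: Dodson1984, §3.2.1 Theorem (proof)] -/
theorem cmTypeRank_blockType (hcomm : ∀ g h : K ≃ₐ[ℚ] K, g * h = h * g)
    (hρ : ∀ x, φ₀ (ρ x) = starRingEnd ℂ (φ₀ x)) (hσ : orderOf σ = n) (hρσ : ρ ∉ Subgroup.zpowers σ)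
    (hK : Module.finrank ℚ K = 2 * n) (hΦσ : ∀ i : ℕ, embOf φ₀ (σ ^ i) ∈ Φ.1 ↔ l ≤ i % n)
    (hΦρ : ∀ i : ℕ, embOf φ₀ (ρ * σ ^ i) ∈ Φ.1 ↔ i % n < l) (hl : 0 < l) (hln : l ∣ n) (h2l : 2 * l ≠ n) :
    cmTypeRank Φ = n - l + 2 := by
  classical
  letI : CommGroup (K ≃ₐ[ℚ] K) := { (inferInstance : Group (K ≃ₐ[ℚ] K)) with mul_comm := hcomm }
  have hcard : Fintype.card (K ≃ₐ[ℚ] K) = 2 * n := by rw [card_gal_eq_finrank φ₀, hK]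
  obtain ⟨hset, hΦσ', hΦρ'⟩ := galoisType_spec (φ₀ := φ₀) hΦσ hΦρ
  rw [cmTypeRank_eq_typeRank_gal hcomm Φ φ₀, hset]
  exact typeRank_blockType (conjGalElt_ne_one hρ) (conjGalElt_mul_self hρ) hσ hρσ hcard hΦσ' hΦρ' hl hln h2l

/-- **`(K; Φᶠ)` is DEGENERATE** for `l ≥ 2`: `Rank(K; Φᶠ) = n − l + 2 < n + 1` ("`A` is said to be degenerate when
`rank(A) = rank(K, Φ) < n + 1`"). [cite: Dodson1984, §3.1.0 and §3.2.1 Theorem] -/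
theorem not_isNondegenerate_blockType (hcomm : ∀ g h : K ≃ₐ[ℚ] K, g * h = h * g)
    (hρ : ∀ x, φ₀ (ρ x) = starRingEnd ℂ (φ₀ x)) (hσ : orderOf σ = n) (hρσ : ρ ∉ Subgroup.zpowers σ)
    (hK : Module.finrank ℚ K = 2 * n) (hΦσ : ∀ i : ℕ, embOf φ₀ (σ ^ i) ∈ Φ.1 ↔ l ≤ i % n)
    (hΦρ : ∀ i : ℕ, embOf φ₀ (ρ * σ ^ i) ∈ Φ.1 ↔ i % n < l) (hl : 2 ≤ l) (hln : l ∣ n) (h2l : 2 * l ≠ n) :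
    ¬IsNondegenerate Φ := by
  have hn : 0 < n := hσ ▸ orderOf_pos σ
  have hl' : l ≤ n := Nat.le_of_dvd hn hln
  rw [isNondegenerate_iff, cmTypeRank_blockType hcomm hρ hσ hρσ hK hΦσ hΦρ (by omega) hln h2l, hK,
    Nat.mul_div_cancel_left _ (by norm_num : 0 < 2)]
  omega

omit [IsCMField K] in
/-- **`(K; Φᶠ)` is PRIMITIVE** for `0 < l`, `2l < n` ("`Φ` is primitive since the orbit of `f` under `G` has order
`2n`"; Shimura Prop. 26 form `IsPrimitive`, through the separation criterion `isPrimitive_iff_forall_eq`).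
[cite: Dodson1984, §3.2.1 Theorem (proof)] [cite: Shimura1998, §8.2 Prop. 26] -/
theorem isPrimitive_blockType (hcomm : ∀ g h : K ≃ₐ[ℚ] K, g * h = h * g)
    (hρ : ∀ x, φ₀ (ρ x) = starRingEnd ℂ (φ₀ x)) (hσ : orderOf σ = n) (hρσ : ρ ∉ Subgroup.zpowers σ)
    (hK : Module.finrank ℚ K = 2 * n) (hΦσ : ∀ i : ℕ, embOf φ₀ (σ ^ i) ∈ Φ.1 ↔ l ≤ i % n)
    (hΦρ : ∀ i : ℕ, embOf φ₀ (ρ * σ ^ i) ∈ Φ.1 ↔ i % n < l) (hl : 0 < l) (h2l : 2 * l < n)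
    (φh : K →+* ℂ) : IsPrimitive (ℂ ≃+* ℂ) Φ.1 φh := by
  classical
  letI : CommGroup (K ≃ₐ[ℚ] K) := { (inferInstance : Group (K ≃ₐ[ℚ] K)) with mul_comm := hcomm }
  haveI := isPretransitive_ringEquiv_complex (K := K)
  have hcard : Fintype.card (K ≃ₐ[ℚ] K) = 2 * n := by rw [card_gal_eq_finrank φ₀, hK]
  obtain ⟨-, hΦσ', hΦρ'⟩ := galoisType_spec (φ₀ := φ₀) hΦσ hΦρ
  rw [isPrimitive_iff_forall_eq]
  intro x y hxy
  obtain ⟨g, rfl⟩ := (embOf_bijective φ₀).2 x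
  obtain ⟨h, rfl⟩ := (embOf_bijective φ₀).2 y
  congr 1
  refine eq_of_forall_mul_mem_iff_blockType (conjGalElt_mul_self hρ) hσ hρσ hcard hΦσ' hΦρ' hl h2l
    fun γ => ?_
  obtain ⟨τ, hτ⟩ := exists_ringEquiv_comp_eq_algEquiv φ₀ γ⁻¹
  have h1 := hxy τ
  rw [smul_embOf_of_comp φ₀ hτ, smul_embOf_of_comp φ₀ hτ, inv_inv, hcomm g γ, hcomm h γ] at h1
  simpa [Finset.mem_filter] using h1

/-! ### §3 On the abelian varieties of type `(K; Φᶠ)`: simple, of dimension `n`, degenerate of rank `n − l + 2` -/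

variable {A : AbelianVariety ℂ} {ι : 𝓞 K →+* End A} {θ : K →+* Module.End ℂ (complexBetti A.X 1)}

omit [IsCMField K] in
/-- **Every abelian variety of CM type `(K; Φᶠ)` is SIMPLE** (`n = kl`-free form: `0 < l`, `2l < n`) — "`(K, Φ)` is
said to be primitive, and `A` is simple, when `((K, Φ)′)′ = (K, Φ)` (Shimura)".
[cite: Dodson1984, §3.1.0 and §3.2.1 Theorem] [cite: Shimura1998, §8.2 Prop. 26] -/
theorem isSimple_blockType (hcomm : ∀ g h : K ≃ₐ[ℚ] K, g * h = h * g)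
    (hρ : ∀ x, φ₀ (ρ x) = starRingEnd ℂ (φ₀ x)) (hσ : orderOf σ = n) (hρσ : ρ ∉ Subgroup.zpowers σ)
    (hK : Module.finrank ℚ K = 2 * n) (hΦσ : ∀ i : ℕ, embOf φ₀ (σ ^ i) ∈ Φ.1 ↔ l ≤ i % n)
    (hΦρ : ∀ i : ℕ, embOf φ₀ (ρ * σ ^ i) ∈ Φ.1 ↔ i % n < l) (hl : 0 < l) (h2l : 2 * l < n)
    (hA : IsCMTypeRealisation Φ A ι θ) : A.IsSimple :=
  (isSimple_iff_isPrimitive hA φ₀).2 (isPrimitive_blockType hcomm hρ hσ hρσ hK hΦσ hΦρ hl h2l φ₀)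

omit [IsCMField K] [Normal ℚ K] in
/-- `dim A = n` for an abelian variety of CM type `(K; Φ)`, `[K : ℚ] = 2n`. [cite: Shimura1998, §6.2 Thm. 3] -/
theorem dim_eq_blockType (hK : Module.finrank ℚ K = 2 * n) (hA : IsCMTypeRealisation Φ A ι θ) : A.dim = n := by
  have h : A.dim = Module.finrank ℚ K / 2 := Literature.AlgebraicGeometry.Motives.schemeDim_eq_holds hA.1
  rw [hK, Nat.mul_div_cancel_left _ (by norm_num : 0 < 2)] at h
  exact h

/-- **Dodson's rank on the variety: `t(A) = dim MT(H¹(A)) = n − l + 2`** for every abelian variety of CM type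
`(K; Φᶠ)` (`l ∣ n`, `0 < l`, `2l ≠ n`) — the Kubota–Dodson rank IS the dimension of the Mumford–Tate group (Gordon
9.1; tree `mtRank_bettiHodge_eq_cmTypeRank'`). [cite: Dodson1984, §3.1.0 and §3.2.1 Theorem]
[cite: Gordon1999HodgeAVSurvey, §9.1] -/
theorem mtRank_hodge_one_blockType (hcomm : ∀ g h : K ≃ₐ[ℚ] K, g * h = h * g)
    (hρ : ∀ x, φ₀ (ρ x) = starRingEnd ℂ (φ₀ x)) (hσ : orderOf σ = n) (hρσ : ρ ∉ Subgroup.zpowers σ)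
    (hK : Module.finrank ℚ K = 2 * n) (hΦσ : ∀ i : ℕ, embOf φ₀ (σ ^ i) ∈ Φ.1 ↔ l ≤ i % n)
    (hΦρ : ∀ i : ℕ, embOf φ₀ (ρ * σ ^ i) ∈ Φ.1 ↔ i % n < l) (hl : 0 < l) (hln : l ∣ n) (h2l : 2 * l ≠ n)
    (hA : IsCMTypeRealisation Φ A ι θ) :
    haveI := BettiUniverse.finite hA.1 1
    @Motives.HodgeStructure.mtRank _ _ _ Motives.hodgeTensorFacts_holds.{0, 0} _ _
      (BettiUniverse.hodge exists_isReal_hodgeModel_holds hA.1 1) = n - l + 2 := by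
  haveI : Motives.HodgeTensorFacts.{0, 0} := Motives.hodgeTensorFacts_holds.{0, 0}
  have h := Motives.HodgeStructure.mtRank_bettiHodge_eq_cmTypeRank' hA exists_isReal_hodgeModel_holds
    hodgePQ_independent_of_hodgeModel_holds
  rw [cmTypeRank_blockType hcomm hρ hσ hρσ hK hΦσ hΦρ hl hln h2l] at h
  exact h

/-- **Degenerate ⟹ exceptional Hodge classes: some power `Aᴺ` of every abelian variety of CM type `(K; Φᶠ)`
(`l ∣ n`, `2 ≤ l`, `2l < n`) carries a rational `(m, m)`-class outside `Dᵐ(Aᴺ) ⊗ ℂ`** (Pohlmann / Hazama: for a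
simple CM abelian variety, degenerate ⟺ `Hdg(Aᴺ) ≠ Div(Aᴺ)` for some `N`; tree
`exists_exceptional_pow_of_not_isNondegenerate`). [cite: Dodson1984, §3.2.1 Theorem]
[cite: Gordon1999HodgeAVSurvey, Thm. 6.4] -/
theorem exists_exceptional_pow_blockType (hcomm : ∀ g h : K ≃ₐ[ℚ] K, g * h = h * g)
    (hρ : ∀ x, φ₀ (ρ x) = starRingEnd ℂ (φ₀ x)) (hσ : orderOf σ = n) (hρσ : ρ ∉ Subgroup.zpowers σ)
    (hK : Module.finrank ℚ K = 2 * n) (hΦσ : ∀ i : ℕ, embOf φ₀ (σ ^ i) ∈ Φ.1 ↔ l ≤ i % n)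
    (hΦρ : ∀ i : ℕ, embOf φ₀ (ρ * σ ^ i) ∈ Φ.1 ↔ i % n < l) (hl : 2 ≤ l) (hln : l ∣ n) (h2l : 2 * l < n)
    (hA : IsCMTypeRealisation Φ A ι θ) :
    ∃ N m : ℕ, ∃ c : complexBetti (⨁ fun _ : Fin N => A).X (2 * m), IsRationalClass c ∧
      IsOfHodgeType (⨁ fun _ : Fin N => A).dim (⨁ fun _ : Fin N => A).X (2 * m) m m c ∧
      c ∉ divisorClassesSpan (⨁ fun _ : Fin N => A).X (⨁ fun _ : Fin N => A).dim m :=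
  exists_exceptional_pow_of_not_isNondegenerate φ₀
    (isPrimitive_blockType hcomm hρ hσ hρσ hK hΦσ hΦρ (by omega) h2l φ₀)
    (not_isNondegenerate_blockType hcomm hρ hσ hρσ hK hΦσ hΦρ hl hln h2l.ne) hA

end BlockType

/-! ### §4 Dodson 1984 §3.2.1 for the fields `Gal(K/ℚ) = ⟨ρ⟩ × ℤₙ` -/

/-- **Dodson 1984, §3.2.1 (A Converse of Ribet's Theorem) over Dodson's fields.**  Let `K` be a CM field, normal over
`ℚ` with commutative Galois group `⟨ρ⟩ × ⟨σ⟩` (`ρ` = complex conjugation, `σ` of order `n`, `ρ ∉ ⟨σ⟩`,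
`[K : ℚ] = 2n`), and `n = kl` with `k ≥ 3`, `l ≥ 2`.  Then `K` carries a CM type `Φ` which is PRIMITIVE and
DEGENERATE of rank `Rank(K; Φ) = n − l + 2`, and EVERY abelian variety of CM type `(K; Φ)` is a SIMPLE abelian
variety of dimension `n` some power of which carries an exceptional Hodge class (a rational `(m,m)`-class outside
`Dᵐ ⊗ ℂ`). [cite: Dodson1984, §3.2.1 Theorem] -/
theorem exists_simple_degenerate_of_gal (hcomm : ∀ g h : K ≃ₐ[ℚ] K, g * h = h * g)
    (hρ : ∀ x, φ₀ (ρ x) = starRingEnd ℂ (φ₀ x)) (hσ : orderOf σ = n) (hρσ : ρ ∉ Subgroup.zpowers σ)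
    (hK : Module.finrank ℚ K = 2 * n) {k : ℕ} (hk : 3 ≤ k) (hl : 2 ≤ l) (hn : n = k * l) :
    ∃ Φ : CMType K, IsPrimitive (ℂ ≃+* ℂ) Φ.1 φ₀ ∧ cmTypeRank Φ = n - l + 2 ∧ ¬IsNondegenerate Φ ∧
      ∀ (A : AbelianVariety ℂ) (ι : 𝓞 K →+* End A) (θ : K →+* Module.End ℂ (complexBetti A.X 1)),
        IsCMTypeRealisation Φ A ι θ →
          A.IsSimple ∧ A.dim = n ∧
            ∃ N m : ℕ, ∃ c : complexBetti (⨁ fun _ : Fin N => A).X (2 * m), IsRationalClass c ∧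
              IsOfHodgeType (⨁ fun _ : Fin N => A).dim (⨁ fun _ : Fin N => A).X (2 * m) m m c ∧
              c ∉ divisorClassesSpan (⨁ fun _ : Fin N => A).X (⨁ fun _ : Fin N => A).dim m := by
  have hln : l ∣ n := ⟨k, by rw [hn, mul_comm]⟩
  have h2l : 2 * l < n := by rw [hn]; nlinarith
  obtain ⟨Φ, hΦσ, hΦρ⟩ := exists_cmType_blockType hcomm hρ hσ hρσ hK l
  exact ⟨Φ, isPrimitive_blockType hcomm hρ hσ hρσ hK hΦσ hΦρ (by omega) h2l φ₀,
    cmTypeRank_blockType hcomm hρ hσ hρσ hK hΦσ hΦρ (by omega) hln h2l.ne,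
    not_isNondegenerate_blockType hcomm hρ hσ hρσ hK hΦσ hΦρ hl hln h2l.ne,
    fun A ι θ hA => ⟨isSimple_blockType hcomm hρ hσ hρσ hK hΦσ hΦρ (by omega) h2l hA, dim_eq_blockType hK hA,
      exists_exceptional_pow_blockType hcomm hρ hσ hρσ hK hΦσ hΦρ hl hln h2l hA⟩⟩

/-- **"There exist simple degenerate Abelian varieties of dimension `n` and rank `n − l + 2`"** over every field of
Dodson's kind, granted the existence of abelian varieties of prescribed CM type (Shimura §6.2 Thm. 3 — the tree's
record `PicardCM.CMAbelianVarietyRealised`, a HYPOTHESIS here, a theorem Summits-side): a simple abelian `n`-fold `A`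
with `dim MT(H¹(A)) = n − l + 2 < n + 1` and an exceptional Hodge class on some power.
[cite: Dodson1984, §3.2.1 Theorem] [cite: Shimura1998, §6.2 Thm. 3] -/
theorem exists_simple_degenerate_of_cmAbelianVarietyRealised
    (hreal : Literature.NumberTheory.Automorphic.PicardCM.CMAbelianVarietyRealised)
    (hcomm : ∀ g h : K ≃ₐ[ℚ] K, g * h = h * g)
    (hρ : ∀ x, φ₀ (ρ x) = starRingEnd ℂ (φ₀ x)) (hσ : orderOf σ = n) (hρσ : ρ ∉ Subgroup.zpowers σ)
    (hK : Module.finrank ℚ K = 2 * n) {k : ℕ} (hk : 3 ≤ k) (hl : 2 ≤ l) (hn : n = k * l) :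
    ∃ (Φ : CMType K) (A : AbelianVariety ℂ) (ι : 𝓞 K →+* End A) (θ : K →+* Module.End ℂ (complexBetti A.X 1))
      (hA : IsCMTypeRealisation Φ A ι θ),
      A.IsSimple ∧ A.dim = n ∧
        (haveI := BettiUniverse.finite hA.1 1
         @Motives.HodgeStructure.mtRank _ _ _ Motives.hodgeTensorFacts_holds.{0, 0} _ _
           (BettiUniverse.hodge exists_isReal_hodgeModel_holds hA.1 1) = n - l + 2) ∧
        ∃ N m : ℕ, ∃ c : complexBetti (⨁ fun _ : Fin N => A).X (2 * m), IsRationalClass c ∧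
          IsOfHodgeType (⨁ fun _ : Fin N => A).dim (⨁ fun _ : Fin N => A).X (2 * m) m m c ∧
          c ∉ divisorClassesSpan (⨁ fun _ : Fin N => A).X (⨁ fun _ : Fin N => A).dim m := by
  have hln : l ∣ n := ⟨k, by rw [hn, mul_comm]⟩
  have h2l : 2 * l < n := by rw [hn]; nlinarith
  obtain ⟨Φ, hΦσ, hΦρ⟩ := exists_cmType_blockType hcomm hρ hσ hρσ hK l
  obtain ⟨A, ι, θ, hA⟩ := hreal K Φ
  exact ⟨Φ, A, ι, θ, hA, isSimple_blockType hcomm hρ hσ hρσ hK hΦσ hΦρ (by omega) h2l hA, dim_eq_blockType hK hA,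
    mtRank_hodge_one_blockType hcomm hρ hσ hρσ hK hΦσ hΦρ (by omega) hln h2l.ne hA,
    exists_exceptional_pow_blockType hcomm hρ hσ hρσ hK hΦσ hΦρ hl hln h2l hA⟩

end Literature.AlgebraicGeometry.Pohlmann1968

end
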